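import Summits.QuantumAdvantage.QuantumAdvantage.Theorems.CubicForrelationNearExactIsExactTenWindow
import Summits.QuantumAdvantage.QuantumAdvantage.Theorems.CubicForrelationNearExactIsExactCellDecomposition
import Summits.QuantumAdvantage.QuantumAdvantage.Theorems.CubicForrelationNearExactIsExactPeriodLemma
import Summits.QuantumAdvantage.QuantumAdvantage.Theorems.CubicForrelationNearExactIsExactHeavyEnergyBound
import Summits.QuantumAdvantage.QuantumAdvantage.Theorems.CubicForrelationNearExactIsExactAutocorr

/-!
# Crux `CubicForrelation.NearExactIsExact` (stmt-QuantumAdvantage-14043), line `direct-sum-amplification`, lead c6 cycle 2: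
  the UNBALANCED split at `n = 10`, `θ = 7/8` reduces to a finite system of cell congruences on 8 bits

`ten_unbalanced_cells`: for cubic `f, g` on 10 bits with `7/8 < Φ(f,g) < 1` there are `E` (degree `≤ 3`), `D`, `Q` (degree `≤ 2`)
on 8 bits and a bit `bh` with `Q` unbalanced, `|Σ_w (−1)^{Q w}| < 128`, every heavy cell sum `Σ_{D w = a, Q w = bh} (−1)^{E w}(−1)^{w·x}`
equal to `8·odd` and every light one (`Q w = ¬bh`) equal to `4·odd`.  Proof: split covector `c` with `δ = D_c g` an UNBALANCED
quadratic (`ten_window_derivative_unbalanced`); second period `r ∉ {0,c}` (`stub_periodLemma`); basis with `r, c` last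
(`stub_basisWithTwo`, `stub_linearTransport`), normal form `g₁(w ‖ a ‖ b) = E w ⊕ aD w ⊕ bQ w`; Walsh side `W_{g₁} = 16u₁`, relative
tower (`stub_levelOnHyperplane`) + cost identity make `u₁/2` odd on the heavy hyperplane (as in `ten_splitDerivative_unbalanced`);
budget (`stub_heavyEnergyBound`) + Wiener–Khinchin (`tb_sum_W_sq_mul_twist`) bound the bias of `Q`; cell decomposition
(`stub_cellDecomposition`).  `isolation_ten_78_of_census` (…TenIsolation78.lean) concludes modulo the census.  Axioms: standard three.
-/

set_option linter.dupNamespace false -- D-0017: single-problem summit ⇒ `QuantumAdvantage.QuantumAdvantage` by design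

noncomputable section

namespace Summit.QuantumAdvantage.QuantumAdvantage.Theorems.CubicForrelation.NearExactIsExact

open Finset
open scoped Matrix
open Literature.Computability.QuantumComplexity
open Literature.Computability.QuantumComplexity.BuzetChailloux (bxor zeroVec signOf_sq)
open Literature.Computability.QuantumComplexity.DerivativeWalsh (W sum_W_sq)
open Summit.QuantumAdvantage.QuantumAdvantage.Theorems.ExactPairsMaioranaMcFarland.Negative (ind ind_apply ind_injective)
open Summit.QuantumAdvantage.QuantumAdvantage.Theorems.CubicForrelation.ExactPairsMaioranaMcFarland (dnf_twist_eq_chi)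
open Summit.QuantumAdvantage.QuantumAdvantage.Theorems.SignedExactCubicForrelationNotPrBPP (eq_of_signOf_eq)

/-- The cell sum `S_{C[a,q]}(x) = Σ_{w : D w = a, Q w = q} (−1)^{E w} (−1)^{w·x}` written as a sum over all of `𝔽₂⁸`. -/
theorem tuc_cellsum_def (E D Q : (Fin (4 + 4) → Bool) → Bool) (a q : Bool) (x : Fin (4 + 4) → Bool) :
    (∑ w : Fin (4 + 4) → Bool, if (D w = a ∧ (Q w ^^ false) = q) then signOf (E w) * twist w x else 0) =
      ∑ w : Fin (4 + 4) → Bool, if (D w = a ∧ Q w = q) then signOf (E w) * twist w x else 0 := by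
  simp only [Bool.xor_false]

/-- **The unbalanced split reduces to the 8-bit cell congruences.** For cubic `f, g : 𝔽₂¹⁰ → 𝔽₂` with
`7/8 < Φ(f,g) < 1` there are `E` (cubic), `D`, `Q` (quadratic) on 8 bits and `bh : Bool` with `Q` unbalanced,
`|Σ_w (−1)^{Q w}| < 128`, all heavy cell sums `Σ_{D w = a, Q w = bh} (−1)^{E w}(−1)^{w·x}` of the form `8(2k+1)` and all
light cell sums (`Q w = ¬bh`) of the form `4(2k+1)`. [lead c6 cycle 2; the census then shows there is no such `(E,D,Q,bh)`] -/
theorem ten_unbalanced_cells :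
    ∀ (f g : (Fin (4 + 4 + 1 + 1) → Bool) → Bool), IsDegLeFun 3 f → IsDegLeFun 3 g →
      7 / 8 < forrelation f g → forrelation f g < 1 →
      ∃ (E D Q : (Fin (4 + 4) → Bool) → Bool) (bh : Bool),
        IsDegLeFun 3 E ∧ IsDegLeFun 2 D ∧ IsDegLeFun 2 Q ∧
        (∑ w, signOf (Q w)) ≠ 0 ∧ |∑ w, signOf (Q w)| < 128 ∧
        (∀ (a : Bool) (x : Fin (4 + 4) → Bool), ∃ k : ℤ,
          (∑ w : Fin (4 + 4) → Bool, if (D w = a ∧ Q w = bh) then signOf (E w) * twist w x else 0) = 8 * (2 * (k : ℝ) + 1)) ∧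
        (∀ (a : Bool) (x : Fin (4 + 4) → Bool), ∃ k : ℤ,
          (∑ w : Fin (4 + 4) → Bool, if (D w = a ∧ Q w = !bh) then signOf (E w) * twist w x else 0) = 4 * (2 * (k : ℝ) + 1)) := by
  intro f g hf hg hΦ hΦ1
  -- Step 1: the split covector `c` and the unbalanced derivative `δ = D_c g`.
  obtain ⟨u, c, b₀, hu, hc, hc0, hbal⟩ := ten_window_derivative_unbalanced f g hf hg hΦ hΦ1
  have hδdeg : IsDegLeFun 2 (fun y => g y ^^ g (bxor y c)) := stub_derivDegree _ 2 g c hg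
  have hδc : ∀ y, (g (bxor y c) ^^ g (bxor (bxor y c) c)) = (g y ^^ g (bxor y c)) := fun y => by
    rw [show bxor (bxor y c) c = y from funext fun i => by show ((y i ^^ c i) ^^ c i) = y i; cases y i <;> cases c i <;> rfl,
      Bool.xor_comm]
  -- Step 2: a second period `r ∉ {0, c}` of `δ`.
  obtain ⟨r, hr0, hrc, hr⟩ := stub_periodLemma (fun y => g y ^^ g (bxor y c)) c hδdeg hc0 hδc hbal
  -- Step 3: an invertible matrix `N` with columns `r, c` in the last two positions.
  have hir : ind r ≠ 0 := fun h => hr0 (ind_injective (h.trans tb_ind_zeroVec.symm))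
  have hic : ind c ≠ 0 := fun h => hc0 (ind_injective (h.trans tb_ind_zeroVec.symm))
  have hirc : ind r ≠ ind c := fun h => hrc (ind_injective h)
  obtain ⟨N, N', hN'N, hNr, hNc⟩ := stub_basisWithTwo 8 (ind r) (ind c) hir hic hirc
  -- Step 4: transport `f₁ = f ∘ N'ᵀ`, `g₁ = g ∘ N`.
  have hMM : Nᵀ * N'ᵀ = 1 := by rw [← Matrix.transpose_mul, hN'N, Matrix.transpose_one]
  obtain ⟨hΦeq, hWeq⟩ := stub_linearTransport _ N'ᵀ Nᵀ hMM f g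
  simp only [Matrix.transpose_transpose] at hΦeq hWeq
  set g₁ : (Fin (4 + 4 + 1 + 1) → Bool) → Bool := fun y => g (fun i => decide ((N *ᵥ ind y) i = 1)) with hg₁def
  set f₁ : (Fin (4 + 4 + 1 + 1) → Bool) → Bool := fun x => f (fun i => decide ((N'ᵀ *ᵥ ind x) i = 1))
    with hf₁def
  have hrd : ∀ v : Fin (4 + 4 + 1 + 1) → ZMod 2, ind (fun i => decide (v i = 1)) = v := fun v => by
    funext i
    exact (by decide : ∀ a : ZMod 2, (if decide (a = 1) = true then (1 : ZMod 2) else 0) = a) (v i)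
  have hg₁ : IsDegLeFun 3 g₁ := nf_isDegLeFun_mulVec N (fun v i => decide (v i = 1)) hrd hg
  have hf₁ : IsDegLeFun 3 f₁ := nf_isDegLeFun_mulVec N'ᵀ (fun v i => decide (v i = 1)) hrd hf
  set e₈ : Fin (4 + 4 + 1 + 1) → Bool := fun j => decide (j = (⟨8, by norm_num⟩ : Fin (4 + 4 + 1 + 1))) with he₈
  set e₉ : Fin (4 + 4 + 1 + 1) → Bool := fun j => decide (j = (⟨9, by norm_num⟩ : Fin (4 + 4 + 1 + 1))) with he₉
  have hT8 : ∀ y : Fin (4 + 4 + 1 + 1) → Bool,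
      (fun i => decide ((N *ᵥ ind (bxor y e₈)) i = 1)) = bxor (fun i => decide ((N *ᵥ ind y) i = 1)) r := by
    intro y
    rw [tb_ind_bxor, Matrix.mulVec_add, he₈, tb_ind_single, hNr, tb_rd_add_ind]
  have hT9 : ∀ y : Fin (4 + 4 + 1 + 1) → Bool,
      (fun i => decide ((N *ᵥ ind (bxor y e₉)) i = 1)) = bxor (fun i => decide ((N *ᵥ ind y) i = 1)) c := by
    intro y
    rw [tb_ind_bxor, Matrix.mulVec_add, he₉, tb_ind_single, hNc, tb_rd_add_ind]
  have hg₁8 : ∀ y, g₁ (bxor y e₈) = g (bxor (fun i => decide ((N *ᵥ ind y) i = 1)) r) := fun y => by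
    simp only [hg₁def]; rw [hT8]
  have hg₁9 : ∀ y, g₁ (bxor y e₉) = g (bxor (fun i => decide ((N *ᵥ ind y) i = 1)) c) := fun y => by
    simp only [hg₁def]; rw [hT9]
  have hP1 : ∀ y, (g₁ (bxor y e₈) ^^ g₁ (bxor (bxor y e₈) e₉)) = (g₁ y ^^ g₁ (bxor y e₉)) := by
    intro y; rw [hg₁9, hT8, hg₁8, hg₁9]; exact hr _
  have hP2 : ∀ y, (g₁ (bxor y e₉) ^^ g₁ (bxor (bxor y e₉) e₉)) = (g₁ y ^^ g₁ (bxor y e₉)) := by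
    intro y; rw [hg₁9 (bxor y e₉), hT9 y, hg₁9 y]; exact hδc _
  -- Step 5: the normal form `g₁(w ‖ a ‖ b) = E w ⊕ (a ∧ D w) ⊕ (b ∧ Q w)`.
  have h9 : ∀ v : Fin (4 + 4 + 1) → Bool,
      (Fin.snoc v true : Fin (4 + 4 + 1 + 1) → Bool) = bxor (Fin.snoc v false) e₉ := fun v => by
    rw [tb_snoc_true]; rfl
  have h8 : ∀ (w : Fin (4 + 4) → Bool) (b : Bool),
      (Fin.snoc (Fin.snoc w true : Fin (4 + 4 + 1) → Bool) b : Fin (4 + 4 + 1 + 1) → Bool) =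
        bxor (Fin.snoc (Fin.snoc w false : Fin (4 + 4 + 1) → Bool) b) e₈ := fun w b => by
    rw [tb_snoc_snoc_true]; rfl
  obtain ⟨E, hE⟩ : ∃ E : (Fin (4 + 4) → Bool) → Bool,
      ∀ w, E w = g₁ (Fin.snoc (Fin.snoc w false) false) := ⟨_, fun _ => rfl⟩
  obtain ⟨D, hD⟩ : ∃ D : (Fin (4 + 4) → Bool) → Bool,
      ∀ w, D w = (g₁ (Fin.snoc (Fin.snoc w false) false) ^^ g₁ (Fin.snoc (Fin.snoc w true) false)) :=
    ⟨_, fun _ => rfl⟩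
  obtain ⟨Q, hQ⟩ : ∃ Q : (Fin (4 + 4) → Bool) → Bool,
      ∀ w, Q w = (g₁ (Fin.snoc (Fin.snoc w false) false) ^^
        g₁ (bxor (Fin.snoc (Fin.snoc w false) false) e₉)) := ⟨_, fun _ => rfl⟩
  have hQa : ∀ (w : Fin (4 + 4) → Bool) (a : Bool),
      (g₁ (Fin.snoc (Fin.snoc w a) false) ^^ g₁ (bxor (Fin.snoc (Fin.snoc w a) false) e₉)) = Q w := by
    intro w a
    cases a
    · rw [hQ]
    · rw [h8 w false, hP1, ← hQ w]
  have hQab : ∀ (w : Fin (4 + 4) → Bool) (a b : Bool),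
      (g₁ (Fin.snoc (Fin.snoc w a) b) ^^ g₁ (bxor (Fin.snoc (Fin.snoc w a) b) e₉)) = Q w := by
    intro w a b
    cases b
    · exact hQa w a
    · rw [h9, hP2]; exact hQa w a
  have hshape : ∀ (w : Fin (4 + 4) → Bool) (a b : Bool),
      g₁ (Fin.snoc (Fin.snoc w a) b) = (E w ^^ (a && D w) ^^ (b && (Q w ^^ false))) := by
    intro w a b
    have hb1 : g₁ (Fin.snoc (Fin.snoc w a) true) = (g₁ (Fin.snoc (Fin.snoc w a) false) ^^ Q w) := by
      rw [← hQa w a, h9, ← Bool.xor_assoc, Bool.xor_self, Bool.false_xor]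
    have ha1 : g₁ (Fin.snoc (Fin.snoc w true) false) = (E w ^^ D w) := by
      rw [hD, hE, ← Bool.xor_assoc, Bool.xor_self, Bool.false_xor]
    rw [Bool.xor_false]
    cases b
    · cases a
      · rw [hE]; simp
      · rw [ha1]; simp
    · rw [hb1]
      cases a
      · rw [← hE w]; simp
      · rw [ha1]; cases E w <;> cases D w <;> cases Q w <;> decide
  have hEdeg : IsDegLeFun 3 E := by
    rw [show E = fun w => g₁ (Fin.snoc (Fin.snoc w false) false) from funext hE]
    exact tb_isDegLeFun_snoc (tb_isDegLeFun_snoc (F := g₁) hg₁ false) false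
  have hQdeg : IsDegLeFun 2 Q := by
    rw [show Q = fun w => (fun y => g₁ y ^^ g₁ (bxor y e₉)) (Fin.snoc (Fin.snoc w false) false) from funext hQ]
    exact tb_isDegLeFun_snoc (tb_isDegLeFun_snoc (F := fun y => g₁ y ^^ g₁ (bxor y e₉))
      (stub_derivDegree _ 2 g₁ e₉ hg₁) false) false
  have hDdeg : IsDegLeFun 2 D := by
    have hg₁' : IsDegLeFun 3 (fun v : Fin (4 + 4 + 1) → Bool => g₁ (Fin.snoc v false)) :=
      tb_isDegLeFun_snoc (F := g₁) hg₁ false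
    have hder := stub_derivDegree _ 2 (fun v : Fin (4 + 4 + 1) → Bool => g₁ (Fin.snoc v false))
      (fun j => decide (j = Fin.last (4 + 4))) hg₁'
    rw [show D = fun w => (fun v : Fin (4 + 4 + 1) → Bool => g₁ (Fin.snoc v false) ^^
        g₁ (Fin.snoc (bxor v fun j => decide (j = Fin.last (4 + 4))) false)) (Fin.snoc w false) from
      funext fun w => by rw [hD, tb_snoc_true w]]
    exact tb_isDegLeFun_snoc hder false
  -- Step 6: the Walsh side: `W_{g₁} = 16 u₁` with `u₁` odd exactly on the hyperplane `x₉ = ¬b₀`.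
  have hW₁ : ∀ x, W (fun y => signOf (g₁ y)) x = (2 : ℝ) ^ 4 * (u (fun i => decide ((N'ᵀ *ᵥ ind x) i = 1)) : ℝ) :=
    fun x => by simp only [hg₁def]; rw [hWeq x, hu]
  have h9vec : (fun i => decide ((N' *ᵥ ind c) i = 1)) = e₉ := by
    rw [← hNc, Matrix.mulVec_mulVec, hN'N, Matrix.one_mulVec]
    funext i
    rw [he₉, Pi.single_apply]
    by_cases h : i = ⟨9, by norm_num⟩ <;> simp [h]
  have hpar : ∀ x : Fin (4 + 4 + 1 + 1) → Bool,
      decide (Odd (u (fun i => decide ((N'ᵀ *ᵥ ind x) i = 1)))) = (b₀ ^^ x ⟨9, by norm_num⟩) := by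
    intro x
    have h1 := hc (fun i => decide ((N'ᵀ *ᵥ ind x) i = 1))
    have htw : twist c (fun i => decide ((N'ᵀ *ᵥ ind x) i = 1)) = twist (fun i => decide ((N' *ᵥ ind c) i = 1)) x := by
      rw [dnf_twist_eq_chi, dnf_twist_eq_chi, hrd, hrd, Matrix.dotProduct_mulVec, ← Matrix.mulVec_transpose,
        Matrix.transpose_transpose]
    rw [htw, h9vec, he₉, tb_twist_single, ← signOf_xor] at h1
    exact eq_of_signOf_eq h1
  -- Step 7: on the hyperplane `x₉ = b₀` the level-5 parity `u₅ = u₁/2` is quadratic (relative tower).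
  have hlast : ∀ (v : Fin (4 + 4 + 1) → Bool) (t : Bool),
      (Fin.snoc v t : Fin (4 + 4 + 1 + 1) → Bool) ⟨9, by norm_num⟩ = t := fun v t => by
    show (Fin.snoc v t : Fin (4 + 4 + 1 + 1) → Bool) (Fin.last (4 + 4 + 1)) = t
    exact Fin.snoc_last (α := fun _ => Bool) t v
  have heven5 : ∀ v : Fin (4 + 4 + 1) → Bool,
      Even (u (fun i => decide ((N'ᵀ *ᵥ ind (Fin.snoc v b₀ : Fin (4 + 4 + 1 + 1) → Bool)) i = 1))) := by
    intro v
    have h := hpar (Fin.snoc v b₀)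
    rw [hlast, Bool.xor_self, decide_eq_false_iff_not] at h
    exact Int.not_odd_iff_even.1 h
  have hoddL : ∀ v : Fin (4 + 4 + 1) → Bool,
      Odd (u (fun i => decide ((N'ᵀ *ᵥ ind (Fin.snoc v (!b₀) : Fin (4 + 4 + 1 + 1) → Bool)) i = 1))) := by
    intro v
    have h := hpar (Fin.snoc v (!b₀))
    rw [hlast, Bool.xor_not_self, decide_eq_true_iff] at h
    exact h
  obtain ⟨u₅, hu₅⟩ : ∃ u₅ : (Fin (4 + 4 + 1) → Bool) → ℤ, ∀ v,
      u (fun i => decide ((N'ᵀ *ᵥ ind (Fin.snoc v b₀ : Fin (4 + 4 + 1 + 1) → Bool)) i = 1)) = 2 * u₅ v := by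
    refine ⟨fun v => u (fun i => decide ((N'ᵀ *ᵥ ind (Fin.snoc v b₀ : Fin (4 + 4 + 1 + 1) → Bool)) i = 1)) / 2,
      fun v => ?_⟩
    show _ = 2 * (u _ / 2)
    obtain ⟨k, hk⟩ := heven5 v
    omega
  set uL : (Fin (4 + 4 + 1) → Bool) → ℤ := fun v =>
    u (fun i => decide ((N'ᵀ *ᵥ ind (Fin.snoc v (!b₀) : Fin (4 + 4 + 1 + 1) → Bool)) i = 1)) with huLdef
  have hW5 : ∀ v : Fin (4 + 4 + 1) → Bool,
      W (fun y => signOf (g₁ y)) (Fin.snoc v b₀) = (2 : ℝ) ^ 5 * (u₅ v : ℝ) := fun v => by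
    rw [hW₁, hu₅]; push_cast; ring
  have hWL : ∀ v : Fin (4 + 4 + 1) → Bool,
      W (fun y => signOf (g₁ y)) (Fin.snoc v (!b₀)) = (16 : ℝ) * (uL v : ℝ) := fun v => by
    rw [hW₁]; norm_num [huLdef]
  have hdeg5 : IsDegLeFun 2 (fun v => decide (Odd (u₅ v))) :=
    stub_levelOnHyperplane stub_axParity 9 5 2 g₁ b₀ u₅ hg₁ hW5 (by intro k hk hk9; omega)
  -- Step 8: the cost identity, split along the last coordinate.
  have hcost : ∑ x, (W (fun y => signOf (g₁ y)) x - 32 * signOf (f₁ x)) ^ 2 =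
      (2 : ℝ) ^ 21 * (1 - forrelation f₁ g₁) := by
    have hP : ∑ x, W (fun y => signOf (g₁ y)) x ^ 2 = (2 : ℝ) ^ 20 := by
      rw [sum_W_sq]
      simp only [signOf_sq, Finset.sum_const, Finset.card_univ, Fintype.card_fun, Fintype.card_bool,
        Fintype.card_fin, nsmul_eq_mul, mul_one]
      norm_num
    have hF : ∑ x, signOf (f₁ x) * W (fun y => signOf (g₁ y)) x = (2 : ℝ) ^ 15 * forrelation f₁ g₁ := by
      have h := vg_two_pow_mul_forrelation (m := 5) f₁ g₁
      norm_num at h ⊢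
      exact h.symm
    have hS : ∑ x : Fin (4 + 4 + 1 + 1) → Bool, signOf (f₁ x) ^ 2 = (2 : ℝ) ^ 10 := by
      simp only [signOf_sq, Finset.sum_const, Finset.card_univ, Fintype.card_fun, Fintype.card_bool,
        Fintype.card_fin, nsmul_eq_mul, mul_one]
      norm_num
    have hexp : ∀ x, (W (fun y => signOf (g₁ y)) x - 32 * signOf (f₁ x)) ^ 2 =
        W (fun y => signOf (g₁ y)) x ^ 2 - 64 * (signOf (f₁ x) * W (fun y => signOf (g₁ y)) x) +
          1024 * signOf (f₁ x) ^ 2 := fun x => by ring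
    simp only [hexp, Finset.sum_add_distrib, Finset.sum_sub_distrib, ← Finset.mul_sum, hP, hF, hS]
    ring
  have hsplit := tb_sum_snoc (fun x => (W (fun y => signOf (g₁ y)) x - 32 * signOf (f₁ x)) ^ 2)
  rw [hcost] at hsplit
  have hH' : ∀ v : Fin (4 + 4 + 1) → Bool,
      (W (fun y => signOf (g₁ y)) (Fin.snoc v b₀) - 32 * signOf (f₁ (Fin.snoc v b₀))) ^ 2 =
        1024 * ((u₅ v : ℝ) - signOf (f₁ (Fin.snoc v b₀))) ^ 2 := fun v => by
    rw [hW5]; ring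
  have hL' : ∀ v : Fin (4 + 4 + 1) → Bool,
      (W (fun y => signOf (g₁ y)) (Fin.snoc v (!b₀)) - 32 * signOf (f₁ (Fin.snoc v (!b₀)))) ^ 2 =
        256 * ((uL v : ℝ) - 2 * signOf (f₁ (Fin.snoc v (!b₀)))) ^ 2 := fun v => by
    rw [hWL]; ring
  have hbool : ∀ v : Fin (4 + 4 + 1) → Bool,
      ∑ t : Bool, (W (fun y => signOf (g₁ y)) (Fin.snoc v t) - 32 * signOf (f₁ (Fin.snoc v t))) ^ 2 =
        1024 * ((u₅ v : ℝ) - signOf (f₁ (Fin.snoc v b₀))) ^ 2 +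
          256 * ((uL v : ℝ) - 2 * signOf (f₁ (Fin.snoc v (!b₀)))) ^ 2 := by
    intro v
    rw [Fintype.sum_bool]
    cases b₀
    · rw [← hH', ← hL']; simp only [Bool.not_false]; ring
    · rw [← hH', ← hL']; simp only [Bool.not_true]
  simp only [hbool, Finset.sum_add_distrib] at hsplit
  have hΦ₁ : 7 / 8 < forrelation f₁ g₁ := by rw [hΦeq]; exact hΦ
  have hbudget : ∑ v : Fin (4 + 4 + 1) → Bool, (1024 : ℝ) * ((u₅ v : ℝ) - signOf (f₁ (Fin.snoc v b₀))) ^ 2 +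
      ∑ v : Fin (4 + 4 + 1) → Bool, (256 : ℝ) * ((uL v : ℝ) - 2 * signOf (f₁ (Fin.snoc v (!b₀)))) ^ 2 < 2 ^ 18 := by
    rw [← hsplit]; nlinarith [hΦ₁]
  -- Step 8a: `u₅` is odd everywhere (fewer than 128 even values, Reed–Muller weight of the quadratic parity).
  have hodd5 : ∀ v, Odd (u₅ v) := by
    have hHsum : (2 : ℝ) ^ 17 ≤ ∑ v : Fin (4 + 4 + 1) → Bool,
        (256 : ℝ) * ((uL v : ℝ) - 2 * signOf (f₁ (Fin.snoc v (!b₀)))) ^ 2 := by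
      calc (2 : ℝ) ^ 17 = ∑ _v : Fin (4 + 4 + 1) → Bool, (256 : ℝ) := by
            simp only [Finset.sum_const, Finset.card_univ, Fintype.card_fun, Fintype.card_bool, Fintype.card_fin,
              nsmul_eq_mul]; norm_num
        _ ≤ _ := Finset.sum_le_sum fun v _ => by
            have h1 := tb_one_le_sq_odd_sub _ (hoddL v) (f₁ (Fin.snoc v (!b₀)))
            nlinarith [h1]
    have hsmall : ∑ v : Fin (4 + 4 + 1) → Bool, ((u₅ v : ℝ) - signOf (f₁ (Fin.snoc v b₀))) ^ 2 < 128 := by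
      rw [← Finset.mul_sum] at hbudget
      nlinarith [hbudget, hHsum]
    by_contra hno
    push Not at hno
    obtain ⟨v₀, hv₀⟩ := hno
    have hdegE : IsDegLeFun 2 (fun v => !decide (Odd (u₅ v))) := by
      simpa only [Bool.xor_true] using tb_isDegLeFun_xor_const hdeg5 true
    have hR := bb_rmWeight_holds (4 + 4 + 1) 2 (fun v => !decide (Odd (u₅ v))) hdegE
      ⟨v₀, by simpa using hv₀⟩
    have hcard : ((univ.filter fun v : Fin (4 + 4 + 1) → Bool => (!decide (Odd (u₅ v))) = true).card : ℝ) ≤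
        ∑ v : Fin (4 + 4 + 1) → Bool, ((u₅ v : ℝ) - signOf (f₁ (Fin.snoc v b₀))) ^ 2 := by
      calc ((univ.filter fun v : Fin (4 + 4 + 1) → Bool => (!decide (Odd (u₅ v))) = true).card : ℝ)
          = ∑ v ∈ univ.filter (fun v : Fin (4 + 4 + 1) → Bool => (!decide (Odd (u₅ v))) = true), (1 : ℝ) := by simp
        _ ≤ ∑ v ∈ univ.filter (fun v : Fin (4 + 4 + 1) → Bool => (!decide (Odd (u₅ v))) = true),
              ((u₅ v : ℝ) - signOf (f₁ (Fin.snoc v b₀))) ^ 2 := by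
            refine Finset.sum_le_sum fun v hv => ?_
            rw [Finset.mem_filter] at hv
            have hev : Even (u₅ v) := by
              have := hv.2; simp only [Bool.not_eq_true', decide_eq_false_iff_not] at this
              exact Int.not_odd_iff_even.1 this
            exact tb_one_le_sq_even_sub _ hev _
        _ ≤ _ := Finset.sum_le_sum_of_subset_of_nonneg (Finset.filter_subset _ _) fun v _ _ => sq_nonneg _
    have h128 : (128 : ℝ) ≤ ((univ.filter fun v : Fin (4 + 4 + 1) → Bool => (!decide (Odd (u₅ v))) = true).card : ℝ) := by
      have : 2 ^ (4 + 4 + 1) ≤ 2 ^ 2 * (univ.filter fun v : Fin (4 + 4 + 1) → Bool => (!decide (Odd (u₅ v))) = true).card := hR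
      have : 128 ≤ (univ.filter fun v : Fin (4 + 4 + 1) → Bool => (!decide (Odd (u₅ v))) = true).card := by omega
      exact_mod_cast this
    linarith
  -- Step 9: the budget bounds the heavy energy, hence (Wiener–Khinchin) the bias of `Q`.
  have henergy : ∑ v : Fin (4 + 4 + 1) → Bool, ((u₅ v : ℝ)) ^ 2 < 768 :=
    stub_heavyEnergyBound u₅ uL (fun v => f₁ (Fin.snoc v b₀)) (fun v => f₁ (Fin.snoc v (!b₀))) hodd5 hoddL hbudget
  have henergy' : (512 : ℝ) ≤ ∑ v : Fin (4 + 4 + 1) → Bool, ((u₅ v : ℝ)) ^ 2 := by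
    calc (512 : ℝ) = ∑ _v : Fin (4 + 4 + 1) → Bool, (1 : ℝ) := by
          simp only [Finset.sum_const, Finset.card_univ, Fintype.card_fun, Fintype.card_bool, Fintype.card_fin,
            nsmul_eq_mul]; norm_num
      _ ≤ _ := Finset.sum_le_sum fun v _ => by
          obtain ⟨k, hk⟩ := hodd5 v
          have : (1 : ℤ) ≤ (u₅ v) ^ 2 := by
            rw [hk]
            rcases le_or_gt 0 k with h | h
            · nlinarith
            · have h' : k ≤ -1 := by omega
              nlinarith
          exact_mod_cast this
  have hδ₁sum : ∑ y, signOf (g₁ y ^^ g₁ (bxor y e₉)) = 4 * ∑ w, signOf (Q w) := by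
    rw [tb_sum_snoc, tb_sum_snoc]
    simp only [Fintype.sum_bool, hQab]
    rw [Finset.mul_sum]
    exact Finset.sum_congr rfl fun w _ => by ring
  have hWK : ∑ x, W (fun y => signOf (g₁ y)) x ^ 2 * twist x e₉ =
      (2 : ℝ) ^ (4 + 4 + 1 + 1) * ∑ y, signOf (g₁ y ^^ g₁ (bxor y e₉)) := by
    rw [tb_sum_W_sq_mul_twist]
    simp only [signOf_xor]
  have hWKsplit : ∑ x, W (fun y => signOf (g₁ y)) x ^ 2 * twist x e₉ =
      signOf b₀ * (1024 * ∑ v : Fin (4 + 4 + 1) → Bool, ((u₅ v : ℝ)) ^ 2 - 256 * ∑ v : Fin (4 + 4 + 1) → Bool, ((uL v : ℝ)) ^ 2) := by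
    rw [tb_sum_snoc]
    have htw : ∀ (v : Fin (4 + 4 + 1) → Bool) (t : Bool), twist (Fin.snoc v t : Fin (4 + 4 + 1 + 1) → Bool) e₉ = signOf t := by
      intro v t
      rw [twist_comm, he₉, tb_twist_single, hlast]
    have hb : ∀ v : Fin (4 + 4 + 1) → Bool,
        ∑ t : Bool, W (fun y => signOf (g₁ y)) (Fin.snoc v t) ^ 2 * twist (Fin.snoc v t : Fin (4 + 4 + 1 + 1) → Bool) e₉ =
          signOf b₀ * (1024 * ((u₅ v : ℝ)) ^ 2 - 256 * ((uL v : ℝ)) ^ 2) := by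
      intro v
      rw [Fintype.sum_bool, htw, htw]
      cases b₀
      · simp only [Bool.not_false] at hWL ⊢; rw [hW5, hWL]; norm_num [signOf]; ring
      · simp only [Bool.not_true] at hWL ⊢; rw [hW5, hWL]; norm_num [signOf]; ring
    simp only [hb, ← Finset.mul_sum, Finset.sum_sub_distrib]
  have hPars : (1024 : ℝ) * ∑ v : Fin (4 + 4 + 1) → Bool, ((u₅ v : ℝ)) ^ 2 + 256 * ∑ v : Fin (4 + 4 + 1) → Bool, ((uL v : ℝ)) ^ 2 = 2 ^ 20 := by
    have hP : ∑ x, W (fun y => signOf (g₁ y)) x ^ 2 = (2 : ℝ) ^ 20 := by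
      rw [sum_W_sq]
      simp only [signOf_sq, Finset.sum_const, Finset.card_univ, Fintype.card_fun, Fintype.card_bool,
        Fintype.card_fin, nsmul_eq_mul, mul_one]
      norm_num
    rw [tb_sum_snoc] at hP
    have hb : ∀ v : Fin (4 + 4 + 1) → Bool, ∑ t : Bool, W (fun y => signOf (g₁ y)) (Fin.snoc v t) ^ 2 =
        1024 * ((u₅ v : ℝ)) ^ 2 + 256 * ((uL v : ℝ)) ^ 2 := by
      intro v
      rw [Fintype.sum_bool]
      cases b₀
      · simp only [Bool.not_false] at hWL ⊢; rw [hW5, hWL]; ring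
      · simp only [Bool.not_true] at hWL ⊢; rw [hW5, hWL]; ring
    simp only [hb, Finset.sum_add_distrib, ← Finset.mul_sum] at hP
    exact hP
  have hWK' : ∑ x, W (fun y => signOf (g₁ y)) x ^ 2 * twist x e₉ =
      (1024 : ℝ) * ∑ y, signOf (g₁ y ^^ g₁ (bxor y e₉)) := by
    rw [hWK, show ((2 : ℝ) ^ (4 + 4 + 1 + 1)) = 1024 from by norm_num]
  have hbias : (1024 : ℝ) * (4 * ∑ w, signOf (Q w)) =
      signOf b₀ * (2048 * ∑ v : Fin (4 + 4 + 1) → Bool, ((u₅ v : ℝ)) ^ 2 - 1048576) := by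
    have h256 : (256 : ℝ) * ∑ v : Fin (4 + 4 + 1) → Bool, ((uL v : ℝ)) ^ 2 =
        2 ^ 20 - 1024 * ∑ v : Fin (4 + 4 + 1) → Bool, ((u₅ v : ℝ)) ^ 2 := by linarith [hPars]
    rw [← hδ₁sum, ← hWK', hWKsplit, h256]; ring
  -- Step 10: the transported bias equals the original one, hence is non-zero.
  have hbij := lt_bijective N' N hN'N
  have hδ₁ne : ∑ y, signOf (g₁ y ^^ g₁ (bxor y e₉)) ≠ 0 := by
    have heq : ∑ y, signOf (g₁ y ^^ g₁ (bxor y e₉)) = ∑ z, signOf (g z ^^ g (bxor z c)) := by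
      rw [← Function.Bijective.sum_comp hbij (fun z => signOf (g z ^^ g (bxor z c)))]
      refine Finset.sum_congr rfl fun y _ => ?_
      rw [hg₁9]
    rw [heq]; exact hbal
  have hQne : (∑ w, signOf (Q w)) ≠ 0 := by
    intro h0; apply hδ₁ne; rw [hδ₁sum, h0, mul_zero]
  have hQlt : |∑ w, signOf (Q w)| < 128 := by
    rw [abs_lt]
    cases b₀
    · rw [show signOf false = 1 from by simp [signOf]] at hbias
      constructor <;> linarith [hbias, henergy, henergy']
    · rw [show signOf true = -1 from by simp [signOf]] at hbias
      constructor <;> linarith [hbias, henergy, henergy']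
  -- Step 11: the cell decomposition turns the Walsh values into cell sums.
  have hcell := stub_cellDecomposition E D Q false g₁ hshape
  refine ⟨E, D, Q, b₀, hEdeg, hDdeg, hQdeg, hQne, hQlt, fun a x => ?_, fun a x => ?_⟩
  · refine ⟨(u₅ (Fin.snoc x a) - 1) / 2, ?_⟩
    have h1 := hcell x a b₀
    rw [hW5, tuc_cellsum_def] at h1
    obtain ⟨k, hk⟩ := hodd5 (Fin.snoc x a)
    have hk' : (u₅ (Fin.snoc x a) - 1) / 2 = k := by omega
    rw [hk']
    have : (u₅ (Fin.snoc x a) : ℝ) = 2 * (k : ℝ) + 1 := by rw [hk]; push_cast; ring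
    rw [this] at h1
    linarith
  · refine ⟨(uL (Fin.snoc x a) - 1) / 2, ?_⟩
    have h1 := hcell x a (!b₀)
    rw [hWL, tuc_cellsum_def] at h1
    obtain ⟨k, hk⟩ := hoddL (Fin.snoc x a)
    have hk2 : uL (Fin.snoc x a) = 2 * k + 1 := hk
    have hk' : (uL (Fin.snoc x a) - 1) / 2 = k := by omega
    rw [hk']
    have : (uL (Fin.snoc x a) : ℝ) = 2 * (k : ℝ) + 1 := by rw [hk2]; push_cast; ring
    rw [this] at h1
    linarith

end Summit.QuantumAdvantage.QuantumAdvantage.Theorems.CubicForrelation.NearExactIsExact
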